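import Summits.HodgeConjecture.HodgeCM.StubTree.ObstructionFromTheta_1

/-! PORT of `HodgeCM/StubTree/ObstructionFromTheta.lean` (HodgeCMPerL run 82) — part 2: continuation of `Summits.HodgeConjecture.HodgeCM.StubTree.ObstructionFromTheta_1` (split at a top-level declaration boundary by port_pkg.py; scope re-opened below; declarations unchanged). -/

-- port_pkg: scope re-opened for this part (file-level context, then the namespace/section stack open at the cut)
noncomputable section
namespace HodgeCM
namespace Universe
open Literature.AlgebraicGeometry.Motives (CMType)
open HodgeCM.Prior.Perl34File
variable {U : Universe}
namespace IsoDatum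
variable {L : CMField} {ι₁ : L →+* ℂ} {V : HermSpace3 L ι₁} (D : U.IsoDatum V) (T : U.ThetaModel)
variable {D} {T}
/-- **Isolation on the projector side (PROVED).**  In a good seesaw context, a `(2,0)`-constituent met by a
`(Ψ₀,Ψ₁)`-theta wedge is met by a `(Ψ₂,Ψ₃)`-theta wedge.  Inputs: the five isolation inputs of strategy 1
(`Open_thetaSub`, `Open_thetaGen12`, `Open_thetaReal34`, `Open_chars`, `Open_occ` — PerL v5 Lemma 3.5, Prop 3.6 /
Thm 3.7 via the frozen prior-programme theorem `Perl34.IsolationSetting.C2_S12_eq_S34`, Lemma 4.1(c), 4.2(b)),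
`Fact_innerEmb` + `Fact_hodgeRiemann20` (a nonzero holomorphic two-form has a nonzero `L²` function), (I0) `ProjMem`
and the seam (E) `EmbCompat`.  NO supply input, NO Prop 4.3 (`Open_thetaWedge`), NO Venkataramana.
Proof: `v := emb (θa ∪ θb) = Λ θa θb ∈ S₁₂ = S₃₄ ⊆ closure (span of the (Ψ₂,Ψ₃) theta wedges)`; `P_π v = emb (e_π (θa ∪
θb)) ≠ 0`; the kernel of `P_π` is closed, so `P_π` is nonzero on some `(Ψ₂,Ψ₃)` theta wedge `Λ θc θd = emb (θc ∪ θd)`,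
i.e. `emb (e_π (θc ∪ θd)) ≠ 0`. -/
theorem tMeets23_of_tMeets01 (M : U.ModelAxioms) (h₂ : T.Fact_innerEmb) (h₅ : T.Open_thetaSub)
    (h₇ : T.Open_thetaGen12) (h₈ : T.Open_thetaReal34) (h₉ : T.Open_chars) (h₁₀ : T.Open_occ)
    (hHR : U.Fact_hodgeRiemann20) (hP : D.ProjMem) (hE : D.EmbCompat T) {c : SeesawCtx L}
    (hc : T.GoodCtx ι₁ c) {π : D.A} (h : D.TMeets T π c 0 1) : D.TMeets T π c 2 3 := by
  obtain ⟨Γ, θa, θb, ha, hb, hne⟩ := h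
  obtain ⟨P, hPe⟩ := hE π
  have hH10 : ∀ (i : Fin 4) (Γ : Level V), ∀ ω ∈ T.Theta V c i Γ, ω ∈ U.H10 (U.pms L ι₁ V Γ) :=
    fun i Γ ω hω => U.Uiso_le_H10 M.pull_hodge Γ c.K (c.Ψ i) c.σ (h₅ V c hc i Γ hω)
  have hxF : U.cup2C (U.pms L ι₁ V Γ) 1 θa θb ∈ U.F2 Γ :=
    cup2C_mem_F2 M _ (hH10 0 Γ θa ha) (hH10 1 Γ θb hb)
  -- (1) the `π`-component is visible in `L²`
  have hPv : P (T.Λ Γ θa θb) ≠ 0 := by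
    rw [T.Λ_apply, ← hPe Γ _ hxF]
    exact T.emb_ne_zero M h₂ hHR Γ (hP Γ π _ hxF) hne
  -- (2) `Λ θa θb ∈ S₁₂ = S₃₄` (PerL Lemma 3.5 generation direction + Thm 3.7)
  let S : Perl34.IsolationSetting (T.H V c) (T.HG L ι₁ V) (T.CG V c) (T.G V c) (T.SK V c) (T.SigIdx V c)
      (T.SigIdxG V c) :=
    { core := T.core V c, t12 := T.t12 V c, t34 := T.t34 V c
      H_chars12 := (h₉ V c hc).1, H_chars34 := (h₉ V c hc).2
      H_occ12 := (h₁₀ V c hc).1, H_occ34 := (h₁₀ V c hc).2 }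
  have e : (T.t12 V c).S12 = (T.t34 V c).S12 := S.C2_S12_eq_S34
  have hv34 : T.Λ Γ θa θb ∈ (T.t34 V c).S12 := e ▸ h₇ V c hc Γ θa θb ha hb
  -- (3) `S₃₄ ⊆` closed span of the `(Ψ₂,Ψ₃)` theta wedges (PerL Lemma 3.5, closure form)
  have hle : (T.t34 V c).S12 ≤ (Submodule.span ℂ (T.wedgeSet V c 2 3)).topologicalClosure := by
    rw [(T.t34 V c).S12_def]
    refine Submodule.topologicalClosure_minimal _ (Submodule.span_le.mpr ?_)
      (Submodule.isClosed_topologicalClosure _)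
    rintro u ⟨χ, hχ, Φ, rfl⟩
    exact h₈ V c hc χ hχ Φ
  -- (4) closed kernel: `P_π` is nonzero on some `(Ψ₂,Ψ₃)` theta wedge
  obtain ⟨u, ⟨Γ₂, θc, hθc, θd, hθd, rfl⟩, hPu⟩ :=
    exists_apply_ne_zero_of_mem_closure_span P hPv (hle hv34)
  refine ⟨Γ₂, θc, θd, hθc, hθd, fun h0 => hPu ?_⟩
  rw [T.Λ_apply, ← hPe Γ₂ _ (cup2C_mem_F2 M _ (hH10 2 Γ₂ θc hθc) (hH10 3 Γ₂ θd hθd)), h0, map_zero]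

/-- **(TV) ⇒ (P♭)**: theta visibility and the isolation inputs give the support inclusion of `PairingReduction`. -/
theorem supportIncl_of_thetaVisible (M : U.ModelAxioms) (h₂ : T.Fact_innerEmb) (h₅ : T.Open_thetaSub)
    (h₇ : T.Open_thetaGen12) (h₈ : T.Open_thetaReal34) (h₉ : T.Open_chars) (h₁₀ : T.Open_occ)
    (hHR : U.Fact_hodgeRiemann20) (hP : D.ProjMem) (hE : D.EmbCompat T) {K : CMField} {Ψ : Fin 4 → CMType K}
    {σ : K →+* ℂ} (hV : D.ThetaVisible T K Ψ σ) : D.SupportIncl K Ψ σ := by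
  intro π hπ
  obtain ⟨Dsee, hc, ht⟩ := hV π hπ
  exact meets_of_tMeets h₅ hc (tMeets23_of_tMeets01 M h₂ h₅ h₇ h₈ h₉ h₁₀ hHR hP hE hc ht)

/-- (TV) ⇒ (P♮) (with (I1) `Decomp`). -/
theorem obstruction_of_thetaVisible (M : U.ModelAxioms) (h₂ : T.Fact_innerEmb) (h₅ : T.Open_thetaSub)
    (h₇ : T.Open_thetaGen12) (h₈ : T.Open_thetaReal34) (h₉ : T.Open_chars) (h₁₀ : T.Open_occ)
    (hHR : U.Fact_hodgeRiemann20) (hd : D.Decomp) (hP : D.ProjMem) (hE : D.EmbCompat T) {K : CMField}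
    {Ψ : Fin 4 → CMType K} {σ : K →+* ℂ} (hV : D.ThetaVisible T K Ψ σ) : D.Obstruction K Ψ σ :=
  D.obstruction_of_supportIncl M hd (supportIncl_of_thetaVisible M h₂ h₅ h₇ h₈ h₉ h₁₀ hHR hP hE hV)

/-- (TV) ∧ (V₂) ⇒ (P♮₂). -/
theorem freeObstruction_of_thetaVisible (M : U.ModelAxioms) (hVC : U.VirtualCup11₂ V) (h₂ : T.Fact_innerEmb)
    (h₅ : T.Open_thetaSub) (h₇ : T.Open_thetaGen12) (h₈ : T.Open_thetaReal34) (h₉ : T.Open_chars)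
    (h₁₀ : T.Open_occ) (hHR : U.Fact_hodgeRiemann20) (hd : D.Decomp) (hP : D.ProjMem) (hE : D.EmbCompat T)
    {K : CMField} {Ψ : Fin 4 → CMType K} {σ : K →+* ℂ} (hV : D.ThetaVisible T K Ψ σ) :
    D.FreeObstruction K Ψ σ :=
  D.freeObstruction_of_virtualCup_obstruction M.pull_comp hVC
    (obstruction_of_thetaVisible M h₂ h₅ h₇ h₈ h₉ h₁₀ hHR hd hP hE hV)

/-- **(TS) ∧ (CG) ⇒ (TV)** (bilinearity of `(x, y) ↦ e_π (x ∪ y)`): the residual does not involve the isotypic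
datum at all. -/
theorem thetaVisible_of_span_glue (D : U.IsoDatum V) {K : CMField} {Ψ : Fin 4 → CMType K} {σ : K →+* ℂ}
    (hS : T.ThetaSpan V K Ψ σ) (hG : T.ContextGlue V K Ψ σ) : D.ThetaVisible T K Ψ σ := by
  intro π hπ
  obtain ⟨Γ, ωa, ωb, ha, hb, hne⟩ := hπ
  set Sa := {θ | ∃ Dsee : StubTree.SeesawDatum L, T.GoodCtx ι₁ ⟨K, Ψ, σ, Dsee⟩ ∧
    θ ∈ T.Theta V ⟨K, Ψ, σ, Dsee⟩ 0 Γ} with hSa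
  set Sb := {θ | ∃ Dsee : StubTree.SeesawDatum L, T.GoodCtx ι₁ ⟨K, Ψ, σ, Dsee⟩ ∧
    θ ∈ T.Theta V ⟨K, Ψ, σ, Dsee⟩ 1 Γ} with hSb
  have key : ∃ θa ∈ Sa, ∃ θb ∈ Sb, D.proj Γ π (U.cup2C (U.pms L ι₁ V Γ) 1 θa θb) ≠ 0 := by
    by_contra h
    simp only [not_exists, not_and, not_not] at h
    apply hne
    have h1 : ∀ y ∈ Sb, ∀ x ∈ Submodule.span ℂ Sa, D.proj Γ π (U.cup2C (U.pms L ι₁ V Γ) 1 x y) = 0 := by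
      intro y hy x hx
      refine Submodule.span_induction (p := fun x _ => D.proj Γ π (U.cup2C (U.pms L ι₁ V Γ) 1 x y) = 0)
        ?_ ?_ ?_ ?_ hx
      · exact fun x hx => h x hx y hy
      · simp
      · intro x x' _ _ hx hx'
        simp only [map_add, LinearMap.add_apply, hx, hx', add_zero]
      · intro a x _ hx
        simp only [map_smul, LinearMap.smul_apply, hx, smul_zero]
    have h2 : ∀ y ∈ Submodule.span ℂ Sb, D.proj Γ π (U.cup2C (U.pms L ι₁ V Γ) 1 ωa y) = 0 := by
      intro y hy
      refine Submodule.span_induction (p := fun y _ => D.proj Γ π (U.cup2C (U.pms L ι₁ V Γ) 1 ωa y) = 0)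
        ?_ ?_ ?_ ?_ hy
      · exact fun y hy => h1 y hy ωa ((hS Γ).1 ha)
      · simp
      · intro y y' _ _ hy hy'
        simp only [map_add, hy, hy', add_zero]
      · intro a y _ hy
        simp only [map_smul, hy, smul_zero]
    exact h2 ωb ((hS Γ).2 hb)
  obtain ⟨θa, ⟨Da, hDa, hθa⟩, θb, ⟨Db, hDb, hθb⟩, hπ'⟩ := key
  obtain ⟨Dc, hDc, hsub⟩ := hG Da Db hDa hDb
  exact ⟨Dc, hDc, Γ, θa, θb, (hsub Γ).1 hθa, (hsub Γ).2 hθb, hπ'⟩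

/-- (TS) ∧ (CG) ⇒ (P♭), over the print-interface clauses (I0) and (E). -/
theorem supportIncl_of_thetaSpan (M : U.ModelAxioms) (h₂ : T.Fact_innerEmb) (h₅ : T.Open_thetaSub)
    (h₇ : T.Open_thetaGen12) (h₈ : T.Open_thetaReal34) (h₉ : T.Open_chars) (h₁₀ : T.Open_occ)
    (hHR : U.Fact_hodgeRiemann20) (hP : D.ProjMem) (hE : D.EmbCompat T) {K : CMField} {Ψ : Fin 4 → CMType K}
    {σ : K →+* ℂ} (hS : T.ThetaSpan V K Ψ σ) (hG : T.ContextGlue V K Ψ σ) : D.SupportIncl K Ψ σ :=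
  supportIncl_of_thetaVisible M h₂ h₅ h₇ h₈ h₉ h₁₀ hHR hP hE (thetaVisible_of_span_glue D hS hG)

end IsoDatum

/-! ### Under the face and the PerL binders; the headline theorems -/

variable (U)

/-- **The isotypic datum with its embedding seam, faces**: for every Galois CM field `F` with `[F:ℚ] ≥ 6`, face `f`,
admissible `ι₁` and hermitian space `V`, an isotypic datum of the tower satisfying the PRINT-INTERFACE package (I0)–(I6)
of `PairingReduction` and the PRINT-INTERFACE seam (E) for the theta model `T`.  Entirely print-interface. -/
def IsoEmbFace (Hk : U.HeckeData) (T : U.ThetaModel) : Prop :=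
  ∀ (F : CMField), IsGalois ℚ F → 6 ≤ Module.finrank ℚ F →
    ∀ (f : Face F) (ι₁ : F →+* ℂ), f.Admissible ι₁ → ∀ V : HermSpace3 F ι₁,
      ∃ D : U.IsoDatum V, D.Standard Hk ∧ D.EmbCompat T

/-- The same under the PerL binders. -/
def IsoEmbPerL (Hk : U.HeckeData) (T : U.ThetaModel) : Prop :=
  ∀ (K L : CMField) (j : K →+* L), IsNormalClosure ℚ K L →
    Module.finrank ℚ K = 6 → (Module.finrank ℚ L = 24 ∨ Module.finrank ℚ L = 48) →
    ∀ (φ : Fin 3 → (K →+* ℂ)), IsFrame φ →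
    ∀ (ι₁ : L →+* ℂ), ι₁.comp j = φ 0 →
    ∀ (t : Fin 4 → CMType K), IsPerLTypes φ t →
    ∀ V : HermSpace3 L ι₁, ∃ D : U.IsoDatum V, D.Standard Hk ∧ D.EmbCompat T

/-- **THE RESIDUAL for faces**: theta span (TS) and context glue (CG) for the four face types at `ι₁`. -/
def ThetaSpanFace (T : U.ThetaModel) : Prop :=
  ∀ (F : CMField), IsGalois ℚ F → 6 ≤ Module.finrank ℚ F →
    ∀ (f : Face F) (ι₁ : F →+* ℂ), f.Admissible ι₁ → ∀ V : HermSpace3 F ι₁,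
      T.ThetaSpan V F f.psi ι₁ ∧ T.ContextGlue V F f.psi ι₁

/-- THE RESIDUAL under the PerL binders. -/
def ThetaSpanPerL (T : U.ThetaModel) : Prop :=
  ∀ (K L : CMField) (j : K →+* L), IsNormalClosure ℚ K L →
    Module.finrank ℚ K = 6 → (Module.finrank ℚ L = 24 ∨ Module.finrank ℚ L = 48) →
    ∀ (φ : Fin 3 → (K →+* ℂ)), IsFrame φ →
    ∀ (ι₁ : L →+* ℂ), ι₁.comp j = φ 0 →
    ∀ (t : Fin 4 → CMType K), IsPerLTypes φ t →
    ∀ V : HermSpace3 L ι₁, T.ThetaSpan V K t (φ 0) ∧ T.ContextGlue V K t (φ 0)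

variable {U} {Hk : U.HeckeData} {T : U.ThetaModel}

/-- (I0)–(I6) ∧ (E) ∧ (TS) ∧ (CG) ∧ isolation ⇒ the isotypic pairing package of `PairingReduction`, faces. -/
theorem isoPairingFace_of_thetaSpan (M : U.ModelAxioms) (h₂ : T.Fact_innerEmb) (h₅ : T.Open_thetaSub)
    (h₇ : T.Open_thetaGen12) (h₈ : T.Open_thetaReal34) (h₉ : T.Open_chars) (h₁₀ : T.Open_occ)
    (hHR : U.Fact_hodgeRiemann20) (hD : U.IsoEmbFace Hk T) (hR : U.ThetaSpanFace T) : U.IsoPairingFace Hk := by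
  intro F hG h6 f ι₁ hadm V
  obtain ⟨D, hS, hE⟩ := hD F hG h6 f ι₁ hadm V
  obtain ⟨hTS, hCG⟩ := hR F hG h6 f ι₁ hadm V
  exact ⟨D, hS, D.obstruction_of_supportIncl M hS.decomp
    (IsoDatum.supportIncl_of_thetaSpan M h₂ h₅ h₇ h₈ h₉ h₁₀ hHR hS.projMem hE hTS hCG)⟩

/-- The same under the PerL binders. -/
theorem isoPairingPerL_of_thetaSpan (M : U.ModelAxioms) (h₂ : T.Fact_innerEmb) (h₅ : T.Open_thetaSub)
    (h₇ : T.Open_thetaGen12) (h₈ : T.Open_thetaReal34) (h₉ : T.Open_chars) (h₁₀ : T.Open_occ)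
    (hHR : U.Fact_hodgeRiemann20) (hD : U.IsoEmbPerL Hk T) (hR : U.ThetaSpanPerL T) : U.IsoPairingPerL Hk := by
  intro K L j hN hK hL φ hφ ι₁ hι t ht V
  obtain ⟨D, hS, hE⟩ := hD K L j hN hK hL φ hφ ι₁ hι t ht V
  obtain ⟨hTS, hCG⟩ := hR K L j hN hK hL φ hφ ι₁ hι t ht V
  exact ⟨D, hS, D.obstruction_of_supportIncl M hS.decomp
    (IsoDatum.supportIncl_of_thetaSpan M h₂ h₅ h₇ h₈ h₉ h₁₀ hHR hS.projMem hE hTS hCG)⟩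

/-- … hence the FREE package (with Venkataramana's (V₂)). -/
theorem isoFreeFace_of_thetaSpan (M : U.ModelAxioms) (hV : U.Fact_virtualCup11₂) (h₂ : T.Fact_innerEmb)
    (h₅ : T.Open_thetaSub) (h₇ : T.Open_thetaGen12) (h₈ : T.Open_thetaReal34) (h₉ : T.Open_chars)
    (h₁₀ : T.Open_occ) (hHR : U.Fact_hodgeRiemann20) (hD : U.IsoEmbFace Hk T) (hR : U.ThetaSpanFace T) :
    U.IsoFreeFace Hk :=
  isoFreeFace_of_virtualCup_iso M hV (isoPairingFace_of_thetaSpan M h₂ h₅ h₇ h₈ h₉ h₁₀ hHR hD hR)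

variable (U)

/-- **COR-CM, gen 6 form of the lineage's headline.**  `HC_CM` from: the 28 model facts `M`; (V) `Fact_virtualCup11₂`
(PRINT: Venkataramana 2001 Thm 8); (S) `LiuSupplyFace` (PRINT [Liu21, KS97, Rog90 §15.3] ∧ `Dict`, gen 3); the five
ISOLATION inputs of the theta model (`Open_thetaSub`, `Open_thetaGen12`, `Open_thetaReal34`, `Open_chars`, `Open_occ` —
strategy 1's prover-owned inputs, shared verbatim with `HodgeCM.Proofs.RealisationConstruction`) with `Fact_innerEmb`,
`Fact_hodgeRiemann20`; the PRINT-INTERFACE datum package `IsoEmbFace Hk T` ((I0)–(I6) ∧ (E)); THE RESIDUAL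
`ThetaSpanFace T` ((TS) ∧ (CG)); Pohlmann; [QW8]+Milne.  No realisation input, no Prop 4.3, no supply-side theta input. -/
theorem COR_CM_of_liu_thetaSpan (M : U.ModelAxioms) (hV : U.Fact_virtualCup11₂) (hL : U.LiuSupplyFace)
    {T : U.ThetaModel} (h₂ : T.Fact_innerEmb) (h₅ : T.Open_thetaSub) (h₇ : T.Open_thetaGen12)
    (h₈ : T.Open_thetaReal34) (h₉ : T.Open_chars) (h₁₀ : T.Open_occ) (hHR : U.Fact_hodgeRiemann20)
    {Hk : U.HeckeData} (hD : U.IsoEmbFace Hk T) (hR : U.ThetaSpanFace T) (hPo : U.PohlmannSpan)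
    (hQ : U.Qw8Sufficiency) : U.HC_CM :=
  COR_CM_of_iso_pieces U M hV hL (isoPairingFace_of_thetaSpan M h₂ h₅ h₇ h₈ h₉ h₁₀ hHR hD hR) hPo hQ

/-- **PerL v5 Thm 4.4, gen 6 form.** -/
theorem perL44_of_liu_thetaSpan (M : U.ModelAxioms) (hV : U.Fact_virtualCup11₂) (hL : U.LiuSupplyPerL)
    {T : U.ThetaModel} (h₂ : T.Fact_innerEmb) (h₅ : T.Open_thetaSub) (h₇ : T.Open_thetaGen12)
    (h₈ : T.Open_thetaReal34) (h₉ : T.Open_chars) (h₁₀ : T.Open_occ) (hHR : U.Fact_hodgeRiemann20)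
    {Hk : U.HeckeData} (hD : U.IsoEmbPerL Hk T) (hR : U.ThetaSpanPerL T) : U.PerL44 :=
  perL44_of_iso_pieces U M hV hL (isoPairingPerL_of_thetaSpan M h₂ h₅ h₇ h₈ h₉ h₁₀ hHR hD hR)

/-- **PerL (`W_per^L`), gen 6 form.** -/
theorem perL_of_liu_thetaSpan (M : U.ModelAxioms) (hV : U.Fact_virtualCup11₂) (hL : U.LiuSupplyPerL)
    {T : U.ThetaModel} (h₂ : T.Fact_innerEmb) (h₅ : T.Open_thetaSub) (h₇ : T.Open_thetaGen12)
    (h₈ : T.Open_thetaReal34) (h₉ : T.Open_chars) (h₁₀ : T.Open_occ) (hHR : U.Fact_hodgeRiemann20)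
    {Hk : U.HeckeData} (hD : U.IsoEmbPerL Hk T) (hR : U.ThetaSpanPerL T) : U.PerL :=
  perL_of_liu_isoFree U M hL
    (isoFreePerL_of_virtualCup_iso M hV (isoPairingPerL_of_thetaSpan M h₂ h₅ h₇ h₈ h₉ h₁₀ hHR hD hR))

end Universe

end HodgeCM

end
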